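import Mathlib
import Summits.RiemannHypothesis.RiemannHypothesis.Theorems.WeilFarFloorFormPolarization
import Summits.RiemannHypothesis.RiemannHypothesis.Theorems.WeilFarFloorCouplingTransfer
import Summits.RiemannHypothesis.RiemannHypothesis.Theorems.WeilFarFloorCoshSplitRH
import Summits.RiemannHypothesis.RiemannHypothesis.Theorems.WeilFarFloorCoshOptimalBudgets
import Summits.RiemannHypothesis.RiemannHypothesis.Theorems.WeilFarFloorLawThreshold
import HarnessLib

/-!
# The second-order LOWER bound for the floor gap from a smooth test direction (core, abstract budgets)

Helper file (`--supports stmt-RiemannHypothesis-0098`, lead-track anchor: Weil-positivity window ladder, format-C far bound),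
pure proofs.  Seat rh-explicit-weil-1 gen15 (memo `run/shared/lean/pub/rh-explicit/rh-explicit-weil-1/FORMAT-K3.md` §16.4).

`C = C_a`, `F = T_aC`, `P = a + sinh a`, `R = R_c(a) = Q_a(C)/P`, `G = F − RC`, `ρ = ∫_{(−a,a)} G²` (`J = ρ/P`).

* §1 (RH-free) the anatomy IDENTITY for a real Weil test `v` on `[−a, a]`:
  `Q_a(v) = 2(∫v cosh(·/2))² − 2(∫v sinh(·/2))² − K∫v² + ∫_{(0,∞)}ρ_∞D_t(v) − Re Q_W(v)` (`Q_W` Weil's form; Bombieri's Dirichlet-form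
  shape), hence `Q_a(v) ≥ −2(∫v sinh)² − K∫v² − Re Q_W(v)`.
* §2 (RH-free) the increment of `x·v(x)`: `∫‖(x+h)v(x+h) − xv(x)‖² ≤ 2(a+1)²D_h(v) + 2h²∫v²` (`0 < h ≤ 1`).
* §3 the Rayleigh step with the two-direction test `u = C + v/R` and ABSTRACT budgets on the direction `v`
  (`∫v² ≤ ρ`, `|∫Cv| ≤ E_C`, `|∫Fv − ρ| ≤ E_F`, `|∫v sinh| ≤ S`, `Re Q_W(v) ≤ Z₁∫v² + Z₀`):
  ★ `farCoercivityFloor_sub_coshQuotient_ge_of_direction`: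
  **`λ_max(a) − R ≥ (1 − 3η)·J/R − (2E_F/R + (Z₀ + 2S²)/R² + 2E_C)/P`** once `K + Z₁ ≤ ηR`, `ρ ≤ ηR²P`, `2E_C ≤ ηRP` (`0 ≤ η`).
The direction (with the window identities `∫_{(−a,a)} C·G = 0`, `∫_{(−a,a)} F·G = ρ`) is supplied by `WeilFarFloorResidualDirection` from
`WeilFarFloorSmoothedResidual`, its zero energy `Re Q_W(v)` by `WeilFarFloorZeroEnergyMoments` (under RH); the discharge (imports here: BUILT modules only) `λ_max(a) ≥ R_c(a) + (1−ε)J(a)/R_c(a) − εe^{−a}` is `WeilFarFloorSecondOrderLowerRH`.  Standard axioms only.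
-/

set_option linter.dupNamespace false
set_option autoImplicit false

noncomputable section

open MeasureTheory Set Filter
open scoped Real Topology ArithmeticFunction.vonMangoldt

namespace Summit.RiemannHypothesis.RiemannHypothesis.Theorems.WeilFormatC

namespace FloorSecondOrder

open Literature.NumberTheory.LFunctions FloorCosh FloorCoshSplit

variable {a : ℝ}

/-! ## §1 The anatomy identity (RH-free) -/

/-- **The anatomy of the prime-shift form of one real Weil test (RH-free identity)**: for a real Weil test `v` supported in
`[−a, a]`, `Q_a(v) = 2(∫v cosh(·/2))² − 2(∫v sinh(·/2))² − (2I₀ + log 4π + γ)∫v² + ∫_{(0,∞)}ρ_∞D_t(v) − Re Q_W(v)`. -/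
theorem primeShiftForm_eq_anatomy {v : ℝ → ℝ} (hv : IsWeilTest fun x ↦ (v x : ℂ))
    (hvs : tsupport (fun x ↦ (v x : ℂ)) ⊆ Icc (-a) a) :
    primeShiftForm a v
      = 2 * (∫ t, v t * Real.cosh (t / 2)) ^ 2 - 2 * (∫ t, v t * Real.sinh (t / 2)) ^ 2
        - (2 * (∫ t in Ioi (0 : ℝ), (Real.exp (t / 2) - 1) / (2 * Real.sinh t))
            + (Real.log (4 * π) + Real.eulerMascheroniConstant)) * (∫ x, v x ^ 2)
        + (∫ t in Ioi (0 : ℝ), weilArchDensity t * ∫ x, (v (x + t) - v x) ^ 2)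
        - (weilQuadratic fun x ↦ (v x : ℂ)).re := by
  obtain ⟨-, hvm, ⟨Cv, hCv⟩, hvs0⟩ := weilTest_admissible hv hvs
  set N : ℝ := ∫ x, v x ^ 2 with hNdef
  have hEq := weilQuadratic_re_eq_weilPoleForm_add_weilDirichletEnergy_sub hv hvs
  have hpole : weilPoleForm (fun x ↦ (v x : ℂ))
      = 2 * (∫ t, v t * Real.cosh (t / 2)) ^ 2 - 2 * (∫ t, v t * Real.sinh (t / 2)) ^ 2 := by
    have hC' : (∫ t, (v t : ℂ) * (Real.cosh (t / 2) : ℂ)) = ((∫ t, v t * Real.cosh (t / 2) : ℝ) : ℂ) := by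
      rw [← integral_complex_ofReal]; exact integral_congr_ae (ae_of_all _ fun t ↦ by push_cast; ring)
    have hS' : (∫ t, (v t : ℂ) * (Real.sinh (t / 2) : ℂ)) = ((∫ t, v t * Real.sinh (t / 2) : ℝ) : ℂ) := by
      rw [← integral_complex_ofReal]; exact integral_congr_ae (ae_of_all _ fun t ↦ by push_cast; ring)
    rw [weilPoleForm, hC', hS', Complex.norm_real, Complex.norm_real, Real.norm_eq_abs, Real.norm_eq_abs, sq_abs, sq_abs]
  have hnorm : (∫ x, ‖((v x : ℂ))‖ ^ 2) = N :=
    integral_congr_ae (ae_of_all _ fun x ↦ by simp only [Complex.norm_real, Real.norm_eq_abs, sq_abs])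
  have hinc : ∀ t, weilIncrement (fun x ↦ (v x : ℂ)) t = ∫ x, (v (x + t) - v x) ^ 2 := fun t ↦ by
    unfold weilIncrement
    exact integral_congr_ae (Eventually.of_forall fun x ↦ by
      simp only [← Complex.ofReal_sub, Complex.norm_real, Real.norm_eq_abs, sq_abs])
  have hincQ : ∀ t, ∫ x, (v (x + t) - v x) ^ 2 = 2 * N - 2 * ∫ x, v (x - t) * v x := by
    intro t
    have i1 := integrable_shiftAdd_mul_shiftAdd hvm hCv hvs0 t t
    have i2 := integrable_shiftAdd_mul_shiftAdd hvm hCv hvs0 t 0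
    have i3 := integrable_shiftAdd_mul_shiftAdd hvm hCv hvs0 0 0
    simp only [add_zero] at i2 i3
    have hsq : ∀ y, v y * v y = v y ^ 2 := fun y ↦ by ring
    have e1 : ∫ x, v (x + t) * v (x + t) = N := by
      rw [integral_add_right_eq_self (fun y ↦ v y * v y) t]; simp_rw [hsq]; rfl
    have e2 : ∫ x, v (x + t) * v x = ∫ x, v (x - t) * v x := by
      rw [← integral_add_right_eq_self (fun y ↦ v (y + t) * v y) (-t)]
      refine integral_congr_ae (Eventually.of_forall fun x ↦ ?_)
      show v (x + -t + t) * v (x + -t) = v (x - t) * v x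
      rw [neg_add_cancel_right, ← sub_eq_add_neg, mul_comm]
    have e3 : ∫ x, v x * v x = N := by simp_rw [hsq]; rfl
    have e : ∀ x, (v (x + t) - v x) ^ 2 = v (x + t) * v (x + t) - 2 * (v (x + t) * v x) + v x * v x := fun x ↦ by ring
    simp_rw [e]
    rw [integral_add (f := fun x ↦ v (x + t) * v (x + t) - 2 * (v (x + t) * v x)) (g := fun x ↦ v x * v x)
        (i1.sub (i2.const_mul 2)) i3,
      integral_sub (f := fun x ↦ v (x + t) * v (x + t)) (g := fun x ↦ 2 * (v (x + t) * v x)) i1 (i2.const_mul 2),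
      integral_const_mul, e1, e2, e3]
    ring
  have hQ : primeShiftForm a v = 2 * N * (∑ n ∈ weilPrimeIndex a, (Λ n : ℝ) / Real.sqrt n)
      - ∑ n ∈ weilPrimeIndex a, (Λ n : ℝ) / Real.sqrt n * weilIncrement (fun x ↦ (v x : ℂ)) (Real.log n) := by
    unfold primeShiftForm
    rw [Finset.mul_sum, ← Finset.sum_sub_distrib]
    refine Finset.sum_congr rfl fun n _ ↦ ?_
    rw [hinc, hincQ]; ring
  have hAeq : ∫ t in Ioi (0 : ℝ), weilArchDensity t * weilIncrement (fun x ↦ (v x : ℂ)) t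
      = ∫ t in Ioi (0 : ℝ), weilArchDensity t * ∫ x, (v (x + t) - v x) ^ 2 :=
    setIntegral_congr_fun measurableSet_Ioi fun t _ ↦ by simp only [hinc]
  unfold weilDirichletEnergy weilMarkovConstant at hEq
  rw [hpole, hnorm, hAeq] at hEq
  set E := ∑ n ∈ weilPrimeIndex a, (Λ n : ℝ) / Real.sqrt n * weilIncrement (fun x ↦ (v x : ℂ)) (Real.log n) with hE
  set W := ∑ n ∈ weilPrimeIndex a, (Λ n : ℝ) / Real.sqrt n with hW
  linarith only [hEq, hQ]

/-- **Lower bound of the form of a direction by its zero energy**: for a real Weil test `v` on `[−a, a]`,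
`Q_a(v) ≥ −2(∫v sinh(·/2))² − (2I₀ + log 4π + γ)∫v² − Re Q_W(v)` (pole `cosh` part and archimedean energy dropped). -/
theorem primeShiftForm_ge_neg_of_weilTest {v : ℝ → ℝ} (hv : IsWeilTest fun x ↦ (v x : ℂ))
    (hvs : tsupport (fun x ↦ (v x : ℂ)) ⊆ Icc (-a) a) :
    -(2 * (∫ t, v t * Real.sinh (t / 2)) ^ 2)
        - (2 * (∫ t in Ioi (0 : ℝ), (Real.exp (t / 2) - 1) / (2 * Real.sinh t))
            + (Real.log (4 * π) + Real.eulerMascheroniConstant)) * (∫ x, v x ^ 2)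
        - (weilQuadratic fun x ↦ (v x : ℂ)).re
      ≤ primeShiftForm a v := by
  rw [primeShiftForm_eq_anatomy hv hvs]
  have h1 : 0 ≤ 2 * (∫ t, v t * Real.cosh (t / 2)) ^ 2 := by positivity
  have h2 : 0 ≤ ∫ t in Ioi (0 : ℝ), weilArchDensity t * ∫ x, (v (x + t) - v x) ^ 2 :=
    setIntegral_nonneg measurableSet_Ioi fun t ht ↦
      mul_nonneg (weilArchDensity_pos ht).le (integral_nonneg fun x ↦ sq_nonneg _)
  linarith

/-! ## §2 The increment of `x·v` -/

/-- `∫‖(x+h)v(x+h) − xv(x)‖² ≤ 2(a+1)²·D_h(v) + 2h²·∫v²` for an admissible real `v` on `[−a, a]` and `0 < h ≤ 1`. -/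
theorem integral_sq_shift_sub_mul_x_le {v : ℝ → ℝ} {Cv : ℝ} (hvm : Measurable v) (hCv : ∀ x, |v x| ≤ Cv)
    (hvs : ∀ x, x ∉ Icc (-a) a → v x = 0) {h : ℝ} (hh0 : 0 < h) (hh1 : h ≤ 1) :
    ∫ x : ℝ, ‖((x + h : ℝ) : ℂ) * ((v (x + h) : ℝ) : ℂ) - (x : ℂ) * ((v x : ℝ) : ℂ)‖ ^ 2
      ≤ 2 * (a + 1) ^ 2 * (∫ x, (v (x + h) - v x) ^ 2) + 2 * h ^ 2 * ∫ x, v x ^ 2 := by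
  have iD := integrable_sq_shiftAdd_sub hvm hCv hvs h
  have iN : Integrable fun x ↦ v x ^ 2 := integrable_sq_admissible hvm hCv hvs
  have e : ∀ x : ℝ, ‖((x + h : ℝ) : ℂ) * ((v (x + h) : ℝ) : ℂ) - (x : ℂ) * ((v x : ℝ) : ℂ)‖ ^ 2
      = ((x + h) * v (x + h) - x * v x) ^ 2 := fun x ↦ by
    rw [← Complex.ofReal_mul, show (x : ℂ) * ((v x : ℝ) : ℂ) = ((x * v x : ℝ) : ℂ) by push_cast; ring,
      ← Complex.ofReal_sub, Complex.norm_real, Real.norm_eq_abs, sq_abs]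
  simp_rw [e]
  -- pointwise: `((x+h)Δ + h·v(x))² ≤ 2(a+1)²Δ² + 2h²v(x)²` (where `Δ ≠ 0` forces `|x+h| ≤ a+1`)
  have hpt : ∀ x, ((x + h) * v (x + h) - x * v x) ^ 2 ≤ 2 * (a + 1) ^ 2 * (v (x + h) - v x) ^ 2 + 2 * h ^ 2 * v x ^ 2 := by
    intro x
    have e1 : (x + h) * v (x + h) - x * v x = (x + h) * (v (x + h) - v x) + h * v x := by ring
    rw [e1]
    have hY : ((x + h) * (v (x + h) - v x)) ^ 2 ≤ (a + 1) ^ 2 * (v (x + h) - v x) ^ 2 := by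
      by_cases hx : x ∈ Icc (-a) a ∨ x + h ∈ Icc (-a) a
      · have hxh : |x + h| ≤ a + 1 := by
          rcases hx with hx | hx
          · exact abs_le.2 ⟨by linarith [hx.1], by linarith [hx.2]⟩
          · exact abs_le.2 ⟨by linarith [hx.1], by linarith [hx.2]⟩
        rw [mul_pow, ← sq_abs (x + h)]
        exact mul_le_mul_of_nonneg_right (pow_le_pow_left₀ (abs_nonneg _) hxh 2) (sq_nonneg _)
      · rw [not_or] at hx
        rw [hvs _ hx.1, hvs _ hx.2]; simp
    nlinarith [hY, sq_nonneg ((x + h) * (v (x + h) - v x) - h * v x)]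
  calc ∫ x, ((x + h) * v (x + h) - x * v x) ^ 2
      ≤ ∫ x, (2 * (a + 1) ^ 2 * (v (x + h) - v x) ^ 2 + 2 * h ^ 2 * v x ^ 2) :=
        integral_mono_of_nonneg (Eventually.of_forall fun x ↦ sq_nonneg _) ((iD.const_mul _).add (iN.const_mul _))
          (Eventually.of_forall hpt)
    _ = 2 * (a + 1) ^ 2 * (∫ x, (v (x + h) - v x) ^ 2) + 2 * h ^ 2 * ∫ x, v x ^ 2 := by
        rw [integral_add (iD.const_mul _) (iN.const_mul _), integral_const_mul, integral_const_mul]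

/-! ## §3 The Rayleigh step and the bookkeeping -/

/-- **Bookkeeping of the lower bound.**  If `g ≥ 0`, `R, P > 0`, `ρ ≥ 0`,
`g·(P + 2E_C/R + ρ/R²) ≥ ρ/R·(1 − Q₁/R) − (2E_F/R + Q₀/R² + 2E_C)` with `Q₀, E_C, E_F ≥ 0` and the smallness
`Q₁ ≤ ηR`, `ρ ≤ ηR²P`, `2E_C ≤ ηRP` (`0 ≤ η`), then `g ≥ (1 − 3η)·(ρ/P)/R − (2E_F/R + Q₀/R² + 2E_C)/P`. -/
theorem lower_bookkeeping {g R P ρ Q₀ Q₁ E_C E_F η : ℝ} (hg : 0 ≤ g) (hR : 0 < R) (hP : 0 < P) (hρ : 0 ≤ ρ)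
    (hQ₀ : 0 ≤ Q₀) (hEC : 0 ≤ E_C) (hEF : 0 ≤ E_F) (hη0 : 0 ≤ η)
    (hQ₁ : Q₁ ≤ η * R) (hρR : ρ ≤ η * (R ^ 2 * P)) (hECR : 2 * E_C ≤ η * (R * P))
    (hmain : ρ / R * (1 - Q₁ / R) - (2 * E_F / R + Q₀ / R ^ 2 + 2 * E_C) ≤ g * (P + 2 * E_C / R + ρ / R ^ 2)) :
    (1 - 3 * η) * (ρ / P) / R - (2 * E_F / R + Q₀ / R ^ 2 + 2 * E_C) / P ≤ g := by
  set ERR := 2 * E_F / R + Q₀ / R ^ 2 + 2 * E_C with hERR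
  have hERR0 : 0 ≤ ERR := by rw [hERR]; positivity
  -- the denominator is at most `P(1 + 2η)`
  have hden1 : 2 * E_C / R ≤ η * P := by rw [div_le_iff₀ hR]; linarith only [hECR]
  have hden2 : ρ / R ^ 2 ≤ η * P := by rw [div_le_iff₀ (by positivity)]; linarith only [hρR]
  have hden : P + 2 * E_C / R + ρ / R ^ 2 ≤ P * (1 + 2 * η) := by linarith only [hden1, hden2]
  have hden0 : 0 < P + 2 * E_C / R + ρ / R ^ 2 := by positivity
  -- the numerator is at least `(1 − η)ρ/R − ERR`
  have hnum : (1 - η) * (ρ / R) - ERR ≤ ρ / R * (1 - Q₁ / R) - ERR := by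
    have : Q₁ / R ≤ η := by rw [div_le_iff₀ hR]; exact hQ₁
    have hρR0 : 0 ≤ ρ / R := by positivity
    nlinarith only [this, hρR0]
  -- `g ≥ NUM/(P(1+2η))` whether or not `NUM ≥ 0`
  have hkey : (1 - η) * (ρ / R) - ERR ≤ g * (P * (1 + 2 * η)) := by
    rcases le_or_gt 0 ((1 - η) * (ρ / R) - ERR) with hpos | hneg
    · calc (1 - η) * (ρ / R) - ERR ≤ g * (P + 2 * E_C / R + ρ / R ^ 2) := hnum.trans hmain
        _ ≤ g * (P * (1 + 2 * η)) := mul_le_mul_of_nonneg_left hden hg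
    · have : 0 ≤ g * (P * (1 + 2 * η)) := by positivity
      linarith only [hneg, this]
  have hP2 : 0 < P * (1 + 2 * η) := by positivity
  have h1 : ((1 - η) * (ρ / R) - ERR) / (P * (1 + 2 * η)) ≤ g := by rw [div_le_iff₀ hP2]; exact hkey
  -- `(1−η)/(1+2η) ≥ 1 − 3η` and `ERR/(P(1+2η)) ≤ ERR/P`
  have h2 : (1 - 3 * η) * (ρ / P) / R ≤ (1 - η) * (ρ / R) / (P * (1 + 2 * η)) := by
    rw [div_le_div_iff₀ hR hP2]
    have hρ0' : 0 ≤ ρ / P := by positivity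
    have e : (1 - η) * (ρ / R) * R = (1 - η) * ρ := by field_simp
    rw [e]
    have e2 : (1 - 3 * η) * (ρ / P) * (P * (1 + 2 * η)) = (1 - 3 * η) * (1 + 2 * η) * ρ := by field_simp
    rw [e2]
    nlinarith only [hρ, hη0, mul_nonneg (sq_nonneg η) hρ]
  have h3 : ERR / (P * (1 + 2 * η)) ≤ ERR / P :=
    div_le_div_of_nonneg_left hERR0 hP (by nlinarith only [hP, hη0])
  have e3 : ((1 - η) * (ρ / R) - ERR) / (P * (1 + 2 * η)) = (1 - η) * (ρ / R) / (P * (1 + 2 * η)) - ERR / (P * (1 + 2 * η)) := by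
    rw [sub_div]
  linarith only [h1, h2, h3, e3.le, e3.ge]

/-- ★ **THE LOWER BOUND OF THE GAP FROM A TEST DIRECTION (abstract budgets).**  Let `a > 0`, `C = C_a`, `P = a + sinh a`,
`R = Q_a(C)/P > 0`, `F = T_aC`, and let `v` be a real Weil test supported in `[−a, a]` with `∫v² ≤ ρ`, `|∫C·v| ≤ E_C`,
`|∫F·v − ρ| ≤ E_F`, `|∫v·sinh(·/2)| ≤ S`, `Re Q_W(v) ≤ Z₁∫v² + Z₀` (`Z₁, Z₀, E_C, E_F ≥ 0`, `ρ ≥ 0`), and assume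
`K + Z₁ ≤ ηR`, `ρ ≤ ηR²P`, `2E_C ≤ ηRP` with `0 ≤ η` (`K = 2I₀ + log 4π + γ`).  Then
`λ_max(a) − R ≥ (1 − 3η)(ρ/P)/R − (2E_F/R + (Z₀ + 2S²)/R² + 2E_C)/P`. -/
theorem farCoercivityFloor_sub_coshQuotient_ge_of_direction (ha : 0 < a) {v : ℝ → ℝ}
    (hv : IsWeilTest fun x ↦ (v x : ℂ)) (hvs : tsupport (fun x ↦ (v x : ℂ)) ⊆ Icc (-a) a)
    {ρ E_C E_F S Z₁ Z₀ η : ℝ} (hρ : 0 ≤ ρ) (hEC : 0 ≤ E_C) (hEF : 0 ≤ E_F) (hZ₁ : 0 ≤ Z₁) (hZ₀ : 0 ≤ Z₀)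
    (hη0 : 0 ≤ η)
    (hR : 0 < primeShiftForm a ((Icc (-a) a).indicator (fun y ↦ Real.cosh (y / 2))) / (a + Real.sinh a))
    (hvN : ∫ x, v x ^ 2 ≤ ρ)
    (hCv : |∫ x, (Icc (-a) a).indicator (fun y ↦ Real.cosh (y / 2)) x * v x| ≤ E_C)
    (hFv : |(∫ x, (∑ n ∈ weilPrimeIndex a, (Λ n : ℝ) / Real.sqrt n *
        ((Icc (-a) a).indicator (fun y ↦ Real.cosh (y / 2)) (x - Real.log n)
          + (Icc (-a) a).indicator (fun y ↦ Real.cosh (y / 2)) (x + Real.log n))) * v x) - ρ| ≤ E_F)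
    (hS : |∫ t, v t * Real.sinh (t / 2)| ≤ S)
    (hZ : (weilQuadratic fun x ↦ (v x : ℂ)).re ≤ Z₁ * (∫ x, v x ^ 2) + Z₀)
    (hQ₁ : (2 * (∫ t in Ioi (0 : ℝ), (Real.exp (t / 2) - 1) / (2 * Real.sinh t))
        + (Real.log (4 * π) + Real.eulerMascheroniConstant)) + Z₁
        ≤ η * (primeShiftForm a ((Icc (-a) a).indicator (fun y ↦ Real.cosh (y / 2))) / (a + Real.sinh a)))
    (hρR : ρ ≤ η * ((primeShiftForm a ((Icc (-a) a).indicator (fun y ↦ Real.cosh (y / 2))) / (a + Real.sinh a)) ^ 2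
        * (a + Real.sinh a)))
    (hECR : 2 * E_C ≤ η * (primeShiftForm a ((Icc (-a) a).indicator (fun y ↦ Real.cosh (y / 2))) / (a + Real.sinh a)
        * (a + Real.sinh a))) :
    (1 - 3 * η) * (ρ / (a + Real.sinh a))
          / (primeShiftForm a ((Icc (-a) a).indicator (fun y ↦ Real.cosh (y / 2))) / (a + Real.sinh a))
        - (2 * E_F / (primeShiftForm a ((Icc (-a) a).indicator (fun y ↦ Real.cosh (y / 2))) / (a + Real.sinh a))
            + (Z₀ + 2 * S ^ 2) / (primeShiftForm a ((Icc (-a) a).indicator (fun y ↦ Real.cosh (y / 2))) / (a + Real.sinh a)) ^ 2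
            + 2 * E_C) / (a + Real.sinh a)
      ≤ farCoercivityFloor a
          - primeShiftForm a ((Icc (-a) a).indicator (fun y ↦ Real.cosh (y / 2))) / (a + Real.sinh a) := by
  classical
  -- constants
  set I := ∫ t in Ioi (0 : ℝ), (Real.exp (t / 2) - 1) / (2 * Real.sinh t) with hI
  have hI0 : 0 ≤ I := setIntegral_nonneg measurableSet_Ioi fun t ht ↦ weilKillingDensity_nonneg ht
  have hL0 : 0 ≤ Real.log (4 * π) + Real.eulerMascheroniConstant := by
    have h2 : 0 ≤ Real.log (4 * π) := Real.log_nonneg (by linarith only [Real.pi_gt_three])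
    linarith only [h2, Real.one_half_lt_eulerMascheroniConstant]
  set K := 2 * I + (Real.log (4 * π) + Real.eulerMascheroniConstant) with hKdef
  have hK0 : 0 ≤ K := by rw [hKdef]; linarith only [hI0, hL0]
  clear_value I K
  obtain ⟨hCm, hCb, hCs⟩ := coshTest_admissible a
  set C : ℝ → ℝ := (Icc (-a) a).indicator (fun y ↦ Real.cosh (y / 2)) with hCdef
  set P := a + Real.sinh a with hP
  have hP0 : 0 < P := by have := Real.sinh_pos_iff.2 ha; rw [hP]; linarith
  have hCP : ∫ x, C x ^ 2 = P := by rw [hCdef, hP]; exact integral_coshTest_sq ha.le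
  set R := primeShiftForm a C / P with hRdef
  obtain ⟨-, hvm, ⟨Cv, hCv'⟩, hvs0⟩ := weilTest_admissible hv hvs
  -- the test function `u = C + (1/R)·v`
  set t := 1 / R with ht
  have ht0 : 0 < t := by rw [ht]; positivity
  have hexp := primeShiftForm_add_smul (b := a) hCm hvm hCb hCv' hCs hvs0 t
  rw [bilinear_eq_integral_primeShiftOp_mul hCm hvm hCb hCv' hvs0] at hexp
  -- admissibility of `u` and the floor inequality `Q(u) ≤ λ ∫u²`
  have hum : Measurable fun x ↦ C x + t * v x := hCm.add (hvm.const_mul t)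
  have hub : ∀ x, |C x + t * v x| ≤ Real.cosh (a / 2) + t * Cv := fun x ↦ by
    refine (abs_add_le _ _).trans (add_le_add (hCb x) ?_)
    rw [abs_mul, abs_of_pos ht0]; exact mul_le_mul_of_nonneg_left (hCv' x) ht0.le
  have hus : ∀ x, x ∉ Icc (-a) a → C x + t * v x = 0 := fun x hx ↦ by rw [hCs x hx, hvs0 x hx]; ring
  have hfloor := primeShiftForm_le_floor_mul (a := a) hum hub hus
  rw [hexp] at hfloor
  -- `∫ u² = P + 2t∫Cv + t²∫v²`
  have iCC : Integrable fun x ↦ C x ^ 2 := integrable_sq_admissible hCm hCb hCs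
  have ivv : Integrable fun x ↦ v x ^ 2 := integrable_sq_admissible hvm hCv' hvs0
  have iCv : Integrable fun x ↦ C x * v x := integrable_mul_admissible hCm hCb hvm hCv' hvs0
  have hnorm : ∫ x, (C x + t * v x) ^ 2 = P + 2 * t * (∫ x, C x * v x) + t ^ 2 * ∫ x, v x ^ 2 := by
    have e : (fun x ↦ (C x + t * v x) ^ 2) = fun x ↦ C x ^ 2 + (2 * t) * (C x * v x) + t ^ 2 * v x ^ 2 :=
      funext fun x ↦ by ring
    have i1 : Integrable fun x ↦ C x ^ 2 + (2 * t) * (C x * v x) := iCC.add (iCv.const_mul _)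
    have i2 : Integrable fun x ↦ t ^ 2 * v x ^ 2 := ivv.const_mul _
    have i3 : Integrable fun x ↦ (2 * t) * (C x * v x) := iCv.const_mul _
    rw [e, integral_add i1 i2, integral_add iCC i3, integral_const_mul, integral_const_mul, hCP]
  rw [hnorm] at hfloor
  -- the pieces
  have hlam0 : 0 ≤ farCoercivityFloor a := FloorLaw.farCoercivityFloor_nonneg ha
  have hlamR : R ≤ farCoercivityFloor a := by rw [hRdef, hP, hCdef]; exact coshQuotient_le_farCoercivityFloor ha
  have hQv := primeShiftForm_ge_neg_of_weilTest (a := a) hv hvs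
  rw [← hI, ← hKdef] at hQv
  have hQC : primeShiftForm a C = R * P := by rw [hRdef]; field_simp
  set cv := ∫ x, C x * v x with hcv
  set fv := ∫ x, (∑ n ∈ weilPrimeIndex a, (Λ n : ℝ) / Real.sqrt n * (C (x - Real.log n) + C (x + Real.log n))) * v x with hfv
  set nv := ∫ x, v x ^ 2 with hnv
  set qv := primeShiftForm a v with hqv
  set sv := ∫ t, v t * Real.sinh (t / 2) with hsv
  set zv := (weilQuadratic fun x ↦ (v x : ℂ)).re with hzv
  have hnv0 : 0 ≤ nv := integral_nonneg fun x ↦ sq_nonneg _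
  set lam := farCoercivityFloor a with hlam
  -- signs and elementary consequences
  have hcvE : |cv| ≤ E_C := hCv
  have hfvE : |fv - ρ| ≤ E_F := hFv
  have hS2 : sv ^ 2 ≤ S ^ 2 := by
    have := hS; rw [← sq_abs sv]; exact pow_le_pow_left₀ (abs_nonneg _) this 2
  have hqv' : -(K + Z₁) * nv - (Z₀ + 2 * S ^ 2) ≤ qv := by nlinarith only [hQv, hZ, hS2, hZ₁, hnv0]
  -- from `λ(P + 2t cv + t² nv) ≥ RP + 2t fv + t² qv` to the bookkeeping shape
  set g := lam - R with hg
  have hg0 : 0 ≤ g := by rw [hg]; linarith only [hlamR]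
  have hmain : ρ / R * (1 - (K + Z₁) / R) - (2 * E_F / R + (Z₀ + 2 * S ^ 2) / R ^ 2 + 2 * E_C) ≤ g * (P + 2 * E_C / R + ρ / R ^ 2) := by
    -- `λ·2t·cv ≤ λ·2t·E_C`, `λ t² nv ≤ λ t² ρ`, `fv ≥ ρ − E_F`, `qv ≥ −(K+Z₁)ρ − (Z₀+2S²)`
    have h1 : lam * (2 * t * cv) ≤ lam * (2 * t * E_C) := by
      have : cv ≤ E_C := (le_abs_self _).trans hcvE
      exact mul_le_mul_of_nonneg_left (by nlinarith only [this, ht0]) hlam0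
    have h2 : lam * (t ^ 2 * nv) ≤ lam * (t ^ 2 * ρ) := mul_le_mul_of_nonneg_left (by nlinarith only [hvN, ht0]) hlam0
    have h3 : ρ - E_F ≤ fv := by linarith only [(abs_le.1 hfvE).1]
    have h4 : -(K + Z₁) * ρ - (Z₀ + 2 * S ^ 2) ≤ qv := by nlinarith only [hqv', hvN, hK0, hZ₁, hnv0]
    have h5 : R * P + 2 * t * fv + t ^ 2 * qv ≤ lam * (P + 2 * t * cv + t ^ 2 * nv) := by rw [hQC] at hfloor; linarith only [hfloor]
    have h6 : R * P + 2 * t * (ρ - E_F) + t ^ 2 * (-(K + Z₁) * ρ - (Z₀ + 2 * S ^ 2))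
        ≤ lam * P + lam * (2 * t * E_C) + lam * (t ^ 2 * ρ) := by
      have e : lam * (P + 2 * t * cv + t ^ 2 * nv) = lam * P + lam * (2 * t * cv) + lam * (t ^ 2 * nv) := by ring
      nlinarith only [h5, h1, h2, h3, h4, ht0, e]
    -- substitute `lam = R + g`, `t = 1/R`
    have hl : lam = R + g := by rw [hg]; ring
    rw [hl, ht] at h6
    have e1 : (R + g) * P + (R + g) * (2 * (1 / R) * E_C) + (R + g) * ((1 / R) ^ 2 * ρ)
        = R * P + 2 * E_C + ρ / R + g * (P + 2 * E_C / R + ρ / R ^ 2) := by field_simp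
    have e2 : R * P + 2 * (1 / R) * (ρ - E_F) + (1 / R) ^ 2 * (-(K + Z₁) * ρ - (Z₀ + 2 * S ^ 2))
        = R * P + ρ / R + (ρ / R * (1 - (K + Z₁) / R) - (2 * E_F / R + (Z₀ + 2 * S ^ 2) / R ^ 2 + 2 * E_C)) + 2 * E_C := by
      field_simp; ring
    rw [e1, e2] at h6
    linarith only [h6]
  have hQ₀ : 0 ≤ Z₀ + 2 * S ^ 2 := by positivity
  exact lower_bookkeeping hg0 hR hP0 hρ hQ₀ hEC hEF hη0 hQ₁ hρR hECR hmain

end FloorSecondOrder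

end Summit.RiemannHypothesis.RiemannHypothesis.Theorems.WeilFormatC
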